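import Summits.AtomisticToContinuum.HydrodynamicLimit.Theorems.RelayRaceLocalityConeLocalisationStubLogCurvatureA
import HarnessLib

/-!
# RelayRaceLocality · ConeLocalisation — line `einstein-elevator`, stub `stub_logCurvature` (part B)

Support file for the crux item `stmt-AtomisticToContinuum-12504` (`ConeLocalisation`, route RelayRaceLocality of
`AtomisticToContinuum/HydrodynamicLimit`), second of the files proving the registered stub
`stub_logCurvature : DynamicLogSlopeBound → DynamicLogCurvatureBound` of the line `einstein-elevator`.

This part (namespace `…Elevator.LogCurvature`): the primitive hard-sphere Euler equations in MATERIAL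
form `D_t = ∂ₜ + Σₖ uₖ ∂ₖ` ONE DERIVATIVE UP, along one classical solution whose packing stays in the
smooth EOS band: `Dt_dVelocity` (`D_t ∂ᵢuⱼ = -∂ᵢGⱼ - Σₖ ∂ᵢuₖ ∂ₖuⱼ`, with
`∂ᵢGⱼ = (∂ᵢθ κ + θ κ' ∂ᵢη) ∂ⱼL + θ κ ∂ᵢ∂ⱼL + Zf' ∂ᵢη ∂ⱼθ + Zf ∂ᵢ∂ⱼθ`, `L = log ρ`, `η = ρσ³`,
`κ = Zf + η Zf'`, `κ' = 2 Zf' + η Zf''`), `Dt_logCurv` (the floor-free identity for `∂ᵢ∂ⱼ log ρ`),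
and the guarded bounds `|D_t ∂ᵢρ| ≤ 15 N²`, `|D_t ∂ᵢ∂ⱼθ| ≤ 48 N⁵` (exchange `∂ₜ∂ = ∂∂ₜ`, the
primitive equations of `LogSlope`, Leibniz along coordinate lines, bookkeeping calculus of part A).
-/

noncomputable section

namespace Summit.AtomisticToContinuum.HydrodynamicLimit.Theorems.ConeLocalisation.Elevator.LogCurvature

open scoped Topology ContDiff NNReal
open Filter Set MeasureTheory
open Literature.MathematicalPhysics.KineticTheory Literature.Analysis.FluidPDE
  Literature.Analysis.FunctionSpaces
open Literature.Analysis.FluidPDE.CompressibleEuler (abs_mul_le_of_le)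
open Literature.MathematicalPhysics.KineticTheory.HsEulerCalc

section Eulerian

variable {σ T η₀ : ℝ} {ρ θ : ℝ → T3 → ℝ} {u : ℝ → T3 → V3} {Zf : ℝ → ℝ}

/-! ### Step 5: the velocity gradient in material form -/

/-- **Time derivative of the velocity gradient**: `∂ₜ∂ᵢuⱼ = ∂ᵢ(∂ₜuⱼ)` computed from the velocity
equation in material form (`LogSlope.Dt_velocity`) by the Leibniz rule along the `i`-th coordinate
line: `∂ₜ∂ᵢuⱼ = -Σₖ (∂ᵢuₖ ∂ₖuⱼ + uₖ ∂ᵢ∂ₖuⱼ) - ∂ᵢGⱼ`, `∂ᵢGⱼ` displayed. [folklore] -/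
theorem timeDeriv_dVelocity (hE : IsHardSphereEulerSolution σ T ρ u θ)
    (hZ : ContDiffOn ℝ ∞ Zf (Ioo (-η₀) η₀)) (hEq : EqOn hsCompressibility Zf (Ioo 0 η₀))
    (hσ : 0 < σ) (hpack : ∀ s ∈ Ico 0 T, ∀ x, ρ s x * σ ^ 3 < η₀)
    {s : ℝ} (hs : s ∈ Ico 0 T) (x : T3) (i j : Fin 3) :
    Torus.timeDerivWithin (Ico 0 T) (fun s => Torus.partialDeriv i (fun y => u s y j)) s x =
      -(∑ k, (Torus.partialDeriv i (fun y => u s y k) x * Torus.partialDeriv k (fun y => u s y j) x +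
          u s x k * Torus.partialDeriv i (Torus.partialDeriv k (fun y => u s y j)) x)) -
      ((Torus.partialDeriv i (θ s) x *
            (Zf (ρ s x * σ ^ 3) + ρ s x * σ ^ 3 * deriv Zf (ρ s x * σ ^ 3)) +
          θ s x * ((2 * deriv Zf (ρ s x * σ ^ 3) +
            ρ s x * σ ^ 3 * deriv (deriv Zf) (ρ s x * σ ^ 3)) *
            (Torus.partialDeriv i (ρ s) x * σ ^ 3))) *
          Torus.partialDeriv j (fun z => Real.log (ρ s z)) x +
        θ s x * (Zf (ρ s x * σ ^ 3) + ρ s x * σ ^ 3 * deriv Zf (ρ s x * σ ^ 3)) *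
          Torus.partialDeriv i (Torus.partialDeriv j (fun z => Real.log (ρ s z))) x +
        (deriv Zf (ρ s x * σ ^ 3) * (Torus.partialDeriv i (ρ s) x * σ ^ 3) *
            Torus.partialDeriv j (θ s) x +
          Zf (ρ s x * σ ^ 3) * Torus.partialDeriv i (Torus.partialDeriv j (θ s)) x)) := by
  obtain ⟨hJ, hζ, hdζ⟩ := LogSlope.zeta_smooth hZ σ
  have hO : IsOpen (Ioo (-η₀) η₀) := isOpen_Ioo
  have hZ1 : ContDiffOn ℝ ∞ (deriv Zf) (Ioo (-η₀) η₀) := hZ.deriv_of_isOpen hO le_rfl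
  obtain ⟨-, hζ1, hdζ1⟩ := LogSlope.zeta_smooth hZ1 σ
  obtain ⟨hρJ, -⟩ := LogSlope.density_mem_and_pressure hE hEq hσ hpack
  rw [torus_timeDerivWithin_Ico_partialDeriv_comm (hE.smooth_velocity.apply j) hs i x]
  have hfun : Torus.timeDerivWithin (Ico 0 T) (fun s y => u s y j) s = fun y =>
      -(u s y 0 * Torus.partialDeriv 0 (fun z => u s z j) y +
          u s y 1 * Torus.partialDeriv 1 (fun z => u s z j) y +
          u s y 2 * Torus.partialDeriv 2 (fun z => u s z j) y) -
        (θ s y * (Zf (ρ s y * σ ^ 3) + ρ s y * σ ^ 3 * deriv Zf (ρ s y * σ ^ 3)) *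
            Torus.partialDeriv j (fun z => Real.log (ρ s z)) y +
          Zf (ρ s y * σ ^ 3) * Torus.partialDeriv j (θ s) y) := by
    funext y
    have h := LogSlope.Dt_velocity hE hZ hEq hσ hpack hs y j
    rw [← LogSlope.partialDeriv_log hE hs y j] at h
    simp only [Fin.sum_univ_three] at h
    linarith
  rw [hfun]
  have hθs : Torus.IsSmooth (θ s) := hE.smooth_temperature.isSmooth_slice hs
  have hus : Torus.IsSmooth (u s) := hE.smooth_velocity.isSmooth_slice hs
  have hLs : Torus.IsSmooth (fun z => Real.log (ρ s z)) :=
    (LogSlope.isSmoothSpaceTimeOn_log hE).isSmooth_slice hs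
  have hρ1 : Torus.IsContDiff 1 (ρ s) := (hE.smooth_density.isSmooth_slice hs).isContDiff (by simp)
  have hθ1 : Torus.IsContDiff 1 (θ s) := hθs.isContDiff (by simp)
  have huj1 : ∀ k, Torus.IsContDiff 1 (fun y => u s y k) := fun k =>
    isContDiff_apply_coord (hus.isContDiff (by simp)) k
  have hDu1 : ∀ k, Torus.IsContDiff 1 (Torus.partialDeriv k (fun y => u s y j)) := fun k =>
    ((hus.apply j).partialDeriv k).isContDiff (by simp)
  have hDθ1 : Torus.IsContDiff 1 (Torus.partialDeriv j (θ s)) :=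
    (hθs.partialDeriv j).isContDiff (by simp)
  have hQ1 : Torus.IsContDiff 1 (Torus.partialDeriv j (fun z => Real.log (ρ s z))) :=
    (hLs.partialDeriv j).isContDiff (by simp)
  have cu := fun k => hasDerivAt_coordLine (huj1 k) x i
  have cDu := fun k => hasDerivAt_coordLine (hDu1 k) x i
  have cθ := hasDerivAt_coordLine hθ1 x i
  have cρ := hasDerivAt_coordLine hρ1 x i
  have cη := cρ.mul_const (σ ^ 3)
  have cZ := hasDerivAt_coordLine_comp hρ1 hJ hζ x (hρJ s hs x) i
  rw [hdζ _ (hρJ s hs x)] at cZ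
  have cZ' := hasDerivAt_coordLine_comp hρ1 hJ hζ1 x (hρJ s hs x) i
  rw [hdζ1 _ (hρJ s hs x)] at cZ'
  have cQ := hasDerivAt_coordLine hQ1 x i
  have cΘ := hasDerivAt_coordLine hDθ1 x i
  refine (partialDeriv_eq_of_hasDerivAt (((((cu 0).fun_mul (cDu 0)).fun_add
    ((cu 1).fun_mul (cDu 1))).fun_add ((cu 2).fun_mul (cDu 2))).fun_neg.fun_sub
    (((cθ.fun_mul (cZ.fun_add (cη.fun_mul cZ'))).fun_mul cQ).fun_add (cZ.fun_mul cΘ)))).trans ?_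
  simp only [zero_smul, Torus.proj_zero, add_zero, Fin.sum_univ_three]
  ring

/-- **Velocity gradient in material form**: `D_t ∂ᵢuⱼ = -∂ᵢGⱼ - Σₖ ∂ᵢuₖ ∂ₖuⱼ` (the convective
commutator `Σₖ uₖ (∂ₖ∂ᵢ - ∂ᵢ∂ₖ) uⱼ` vanishes by Schwarz). [folklore] -/
theorem Dt_dVelocity (hE : IsHardSphereEulerSolution σ T ρ u θ)
    (hZ : ContDiffOn ℝ ∞ Zf (Ioo (-η₀) η₀)) (hEq : EqOn hsCompressibility Zf (Ioo 0 η₀))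
    (hσ : 0 < σ) (hpack : ∀ s ∈ Ico 0 T, ∀ x, ρ s x * σ ^ 3 < η₀)
    {s : ℝ} (hs : s ∈ Ico 0 T) (x : T3) (i j : Fin 3) :
    Torus.timeDerivWithin (Ico 0 T) (fun s => Torus.partialDeriv i (fun y => u s y j)) s x +
        ∑ k, u s x k * Torus.partialDeriv k (Torus.partialDeriv i (fun y => u s y j)) x =
      -((Torus.partialDeriv i (θ s) x *
            (Zf (ρ s x * σ ^ 3) + ρ s x * σ ^ 3 * deriv Zf (ρ s x * σ ^ 3)) +
          θ s x * ((2 * deriv Zf (ρ s x * σ ^ 3) +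
            ρ s x * σ ^ 3 * deriv (deriv Zf) (ρ s x * σ ^ 3)) *
            (Torus.partialDeriv i (ρ s) x * σ ^ 3))) *
          Torus.partialDeriv j (fun z => Real.log (ρ s z)) x +
        θ s x * (Zf (ρ s x * σ ^ 3) + ρ s x * σ ^ 3 * deriv Zf (ρ s x * σ ^ 3)) *
          Torus.partialDeriv i (Torus.partialDeriv j (fun z => Real.log (ρ s z))) x +
        (deriv Zf (ρ s x * σ ^ 3) * (Torus.partialDeriv i (ρ s) x * σ ^ 3) *
            Torus.partialDeriv j (θ s) x +
          Zf (ρ s x * σ ^ 3) * Torus.partialDeriv i (Torus.partialDeriv j (θ s)) x)) -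
      ∑ k, Torus.partialDeriv i (fun y => u s y k) x * Torus.partialDeriv k (fun y => u s y j) x := by
  rw [timeDeriv_dVelocity hE hZ hEq hσ hpack hs x i j]
  have hus : Torus.IsSmooth (u s) := hE.smooth_velocity.isSmooth_slice hs
  simp only [Fin.sum_univ_three]
  rw [Torus.partialDeriv_comm (hus.apply j) 0 i x, Torus.partialDeriv_comm (hus.apply j) 1 i x,
    Torus.partialDeriv_comm (hus.apply j) 2 i x]
  ring

/-! ### Step 6: the log-density Hessian in material form -/

/-- **Log-density Hessian in material form** (apply `∂ᵢ` to `LogSlope.Dt_logSlope`; the convective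
commutator vanishes by Schwarz): with `L = log ρ`,
`D_t ∂ᵢ∂ⱼL = -Σₖ ∂ᵢ∂ⱼ∂ₖuₖ - Σₖ (∂ᵢ∂ⱼuₖ ∂ₖL + ∂ⱼuₖ ∂ᵢ∂ₖL + ∂ᵢuₖ ∂ₖ∂ⱼL)` — no `1/ρ`. [folklore] -/
theorem Dt_logCurv (hE : IsHardSphereEulerSolution σ T ρ u θ) {s : ℝ} (hs : s ∈ Ico 0 T)
    (x : T3) (i j : Fin 3) :
    Torus.timeDerivWithin (Ico 0 T)
          (fun s => Torus.partialDeriv i (Torus.partialDeriv j (fun z => Real.log (ρ s z)))) s x +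
        ∑ k, u s x k * Torus.partialDeriv k
          (Torus.partialDeriv i (Torus.partialDeriv j (fun z => Real.log (ρ s z)))) x =
      -(∑ k, Torus.partialDeriv i (Torus.partialDeriv j
          (Torus.partialDeriv k (fun y => u s y k))) x) -
        ∑ k, (Torus.partialDeriv i (Torus.partialDeriv j (fun y => u s y k)) x *
              Torus.partialDeriv k (fun z => Real.log (ρ s z)) x +
            Torus.partialDeriv j (fun y => u s y k) x *
              Torus.partialDeriv i (Torus.partialDeriv k (fun z => Real.log (ρ s z))) x +
            Torus.partialDeriv i (fun y => u s y k) x *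
              Torus.partialDeriv k (Torus.partialDeriv j (fun z => Real.log (ρ s z))) x) := by
  have hL := LogSlope.isSmoothSpaceTimeOn_log hE
  have hU : UniqueDiffOn ℝ (Ico (0 : ℝ) T) := uniqueDiffOn_Ico 0 T
  rw [torus_timeDerivWithin_Ico_partialDeriv_comm (hL.partialDeriv hU j) hs i x]
  have hfun : Torus.timeDerivWithin (Ico 0 T)
      (fun s => Torus.partialDeriv j (fun z => Real.log (ρ s z))) s = fun y =>
      -(Torus.partialDeriv j (Torus.partialDeriv 0 (fun z => u s z 0)) y +
          Torus.partialDeriv j (Torus.partialDeriv 1 (fun z => u s z 1)) y +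
          Torus.partialDeriv j (Torus.partialDeriv 2 (fun z => u s z 2)) y) -
        (Torus.partialDeriv j (fun z => u s z 0) y *
            Torus.partialDeriv 0 (fun z => Real.log (ρ s z)) y +
          Torus.partialDeriv j (fun z => u s z 1) y *
            Torus.partialDeriv 1 (fun z => Real.log (ρ s z)) y +
          Torus.partialDeriv j (fun z => u s z 2) y *
            Torus.partialDeriv 2 (fun z => Real.log (ρ s z)) y) -
        (u s y 0 * Torus.partialDeriv 0 (Torus.partialDeriv j (fun z => Real.log (ρ s z))) y +
          u s y 1 * Torus.partialDeriv 1 (Torus.partialDeriv j (fun z => Real.log (ρ s z))) y +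
          u s y 2 * Torus.partialDeriv 2 (Torus.partialDeriv j (fun z => Real.log (ρ s z))) y) := by
    funext y
    have h := LogSlope.Dt_logSlope hE hs y j
    simp only [Fin.sum_univ_three] at h
    linarith
  rw [hfun]
  have hLs : Torus.IsSmooth (fun z => Real.log (ρ s z)) := hL.isSmooth_slice hs
  have hus : Torus.IsSmooth (u s) := hE.smooth_velocity.isSmooth_slice hs
  have huj1 : ∀ k, Torus.IsContDiff 1 (fun y => u s y k) := fun k =>
    isContDiff_apply_coord (hus.isContDiff (by simp)) k
  have hDu1 : ∀ k, Torus.IsContDiff 1 (Torus.partialDeriv j (fun y => u s y k)) := fun k =>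
    ((hus.apply k).partialDeriv j).isContDiff (by simp)
  have hDDu1 : ∀ k, Torus.IsContDiff 1
      (Torus.partialDeriv j (Torus.partialDeriv k (fun y => u s y k))) := fun k =>
    (((hus.apply k).partialDeriv k).partialDeriv j).isContDiff (by simp)
  have hQ1 : ∀ k, Torus.IsContDiff 1 (Torus.partialDeriv k (fun z => Real.log (ρ s z))) :=
    fun k => (hLs.partialDeriv k).isContDiff (by simp)
  have hDQ1 : ∀ k, Torus.IsContDiff 1
      (Torus.partialDeriv k (Torus.partialDeriv j (fun z => Real.log (ρ s z)))) := fun k =>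
    ((hLs.partialDeriv j).partialDeriv k).isContDiff (by simp)
  have cu := fun k => hasDerivAt_coordLine (huj1 k) x i
  have cDu := fun k => hasDerivAt_coordLine (hDu1 k) x i
  have cDDu := fun k => hasDerivAt_coordLine (hDDu1 k) x i
  have cQ := fun k => hasDerivAt_coordLine (hQ1 k) x i
  have cDQ := fun k => hasDerivAt_coordLine (hDQ1 k) x i
  have hcomp := ((((cDDu 0).fun_add (cDDu 1)).fun_add (cDDu 2)).fun_neg.fun_sub
    ((((cDu 0).fun_mul (cQ 0)).fun_add ((cDu 1).fun_mul (cQ 1))).fun_add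
      ((cDu 2).fun_mul (cQ 2)))).fun_sub
    ((((cu 0).fun_mul (cDQ 0)).fun_add ((cu 1).fun_mul (cDQ 1))).fun_add ((cu 2).fun_mul (cDQ 2)))
  rw [partialDeriv_eq_of_hasDerivAt hcomp]
  simp only [zero_smul, Torus.proj_zero, add_zero, Fin.sum_univ_three]
  rw [Torus.partialDeriv_comm (hLs.partialDeriv j) 0 i x,
    Torus.partialDeriv_comm (hLs.partialDeriv j) 1 i x,
    Torus.partialDeriv_comm (hLs.partialDeriv j) 2 i x]
  ring

/-! ### Step 7: guarded bounds for `D_t ∂ᵢρ` and `D_t ∂ᵢ∂ⱼθ` -/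

/-- **Material derivative of the density gradient, bound**: at a guarded point `|D_t ∂ᵢρ| ≤ 15 N²`
(`∂ₜ∂ᵢρ = ∂ᵢ(∂ₜρ)`, the mass equation, and the bookkeeping calculus). [folklore] -/
theorem abs_Dt_dDensity_le (hE : IsHardSphereEulerSolution σ T ρ u θ) {η M N : ℝ}
    (hMN : M ≤ N) {s : ℝ} (hs : s ∈ Ico 0 T) {x : T3} (hG : GuardAt η M σ ρ θ u s x)
    (i : Fin 3) :
    |Torus.timeDerivWithin (Ico 0 T) (fun s => Torus.partialDeriv i (ρ s)) s x +
        ∑ k, u s x k * Torus.partialDeriv k (Torus.partialDeriv i (ρ s)) x| ≤ 15 * N ^ 2 := by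
  have hρs : Torus.IsSmooth (ρ s) := hE.smooth_density.isSmooth_slice hs
  have hus : Torus.IsSmooth (u s) := hE.smooth_velocity.isSmooth_slice hs
  obtain ⟨-, -, -, hu, hdρ, -, -, hdu, hddu⟩ := LogSlope.guard_bounds hG hMN hus
  obtain ⟨hρN, hddρ, -, -⟩ := guard_bounds3 hG hMN hus
  have hρa : |ρ s x| ≤ N := by rw [abs_of_pos (hE.density_pos s hs x)]; exact hρN
  have hρ1 : Torus.IsContDiff 1 (ρ s) := hρs.isContDiff (by simp)
  have huj1 : ∀ k, Torus.IsContDiff 1 (fun y => u s y k) := fun k =>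
    isContDiff_apply_coord (hus.isContDiff (by simp)) k
  have hDρ1 : ∀ k, Torus.IsContDiff 1 (Torus.partialDeriv k (ρ s)) := fun k =>
    (hρs.partialDeriv k).isContDiff (by simp)
  have hDu1 : ∀ k, Torus.IsContDiff 1 (Torus.partialDeriv k (fun y => u s y k)) := fun k =>
    ((hus.apply k).partialDeriv k).isContDiff (by simp)
  rw [torus_timeDerivWithin_Ico_partialDeriv_comm hE.smooth_density hs i x]
  have hfun : Torus.timeDerivWithin (Ico 0 T) ρ s = fun y =>
      -(ρ s y * Torus.partialDeriv 0 (fun z => u s z 0) y + Torus.partialDeriv 0 (ρ s) y * u s y 0 +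
        (ρ s y * Torus.partialDeriv 1 (fun z => u s z 1) y + Torus.partialDeriv 1 (ρ s) y * u s y 1) +
        (ρ s y * Torus.partialDeriv 2 (fun z => u s z 2) y +
          Torus.partialDeriv 2 (ρ s) y * u s y 2)) := by
    funext y
    rw [hE.timeDeriv_density_eq hs y]
    simp only [Fin.sum_univ_three]
  have A := fun k : Fin 3 =>
    bd_add (bd_mul (bd_coord hρ1 x i hρa (hdρ i)) (bd_coord (hDu1 k) x i (hdu k k) (hddu i k k)))
      (bd_mul (bd_coord (hDρ1 k) x i (hdρ k) (hddρ i k)) (bd_coord (huj1 k) x i (hu k) (hdu i k)))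
  obtain ⟨v, hv, -, hb⟩ := bd_neg (bd_add (bd_add (A 0) (A 1)) (A 2))
  have e : Torus.partialDeriv i (Torus.timeDerivWithin (Ico 0 T) ρ s) x = v := by
    rw [hfun]
    refine partialDeriv_eq_of_hasDerivAt ?_
    exact hasDerivWithinAt_univ.1 hv
  rw [e]
  simp only [Fin.sum_univ_three]
  have c0 := abs_mul_le_of_le (hu 0) (hddρ 0 i)
  have c1 := abs_mul_le_of_le (hu 1) (hddρ 1 i)
  have c2 := abs_mul_le_of_le (hu 2) (hddρ 2 i)
  have key := (abs_add_le _ _).trans (add_le_add hb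
    ((abs_add_le _ _).trans (add_le_add ((abs_add_le _ _).trans (add_le_add c0 c1)) c2)))
  exact key.trans (le_of_eq (by ring))

/-- **Material derivative of the temperature Hessian, bound**: at a guarded point of a solution
whose packing stays in the EOS band, `|D_t ∂ᵢ∂ⱼθ| ≤ 48 N⁵` (`∂ₜ∂ᵢ∂ⱼθ = ∂ᵢ(∂ₜ∂ⱼθ)`, the once
differentiated temperature equation `LogSlope.timeDeriv_dTemperature`, and the bookkeeping
calculus along the `i`-th coordinate line). [folklore] -/
theorem abs_Dt_ddTemperature_le (hE : IsHardSphereEulerSolution σ T ρ u θ)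
    (hZ : ContDiffOn ℝ ∞ Zf (Ioo (-η₀) η₀)) (hEq : EqOn hsCompressibility Zf (Ioo 0 η₀))
    (hσ : 0 < σ) (hσ1 : σ ≤ 1) {η₁ K M N : ℝ} (hη₁₀ : 2 * η₁ ≤ η₀)
    (hband : ∀ η ∈ Icc 0 η₁, |Zf η| ≤ K ∧ |deriv Zf η| ≤ K ∧ |deriv (deriv Zf) η| ≤ K ∧
      |deriv (deriv (deriv Zf)) η| ≤ K ∧ 1 / 2 ≤ Zf η ∧ 1 / 2 ≤ Zf η + η * deriv Zf η)
    (hN : 1 ≤ N) (hMN : M ≤ N) (hKN : K ≤ N)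
    (hpack : ∀ s ∈ Ico 0 T, ∀ x, ρ s x * σ ^ 3 < η₁)
    {s : ℝ} (hs : s ∈ Ico 0 T) {x : T3} (hG : GuardAt η₁ M σ ρ θ u s x) (i j : Fin 3) :
    |Torus.timeDerivWithin (Ico 0 T)
          (fun s => Torus.partialDeriv i (Torus.partialDeriv j (θ s))) s x +
        ∑ k, u s x k *
          Torus.partialDeriv k (Torus.partialDeriv i (Torus.partialDeriv j (θ s))) x| ≤
      48 * N ^ 5 := by
  have hη₁ : 0 < η₁ := (mul_pos (hE.density_pos s hs x) (pow_pos hσ 3)).trans hG.1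
  have hη₀ : ∀ s ∈ Ico 0 T, ∀ x, ρ s x * σ ^ 3 < η₀ := fun s' hs' x' =>
    (hpack s' hs' x').trans_le (by linarith)
  obtain ⟨hJ, hζ, hdζ⟩ := LogSlope.zeta_smooth hZ σ
  have hO : IsOpen (Ioo (-η₀) η₀) := isOpen_Ioo
  have hZ1 : ContDiffOn ℝ ∞ (deriv Zf) (Ioo (-η₀) η₀) := hZ.deriv_of_isOpen hO le_rfl
  obtain ⟨-, hζ1, hdζ1⟩ := LogSlope.zeta_smooth hZ1 σ
  obtain ⟨hρJ, -⟩ := LogSlope.density_mem_and_pressure hE hEq hσ hη₀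
  have hθs : Torus.IsSmooth (θ s) := hE.smooth_temperature.isSmooth_slice hs
  have hρs : Torus.IsSmooth (ρ s) := hE.smooth_density.isSmooth_slice hs
  have hus : Torus.IsSmooth (u s) := hE.smooth_velocity.isSmooth_slice hs
  obtain ⟨hpk, hθN, -, hu, hdρ, hdθ, hddθ, hdu, hddu⟩ := LogSlope.guard_bounds hG hMN hus
  obtain ⟨-, hddρ, hdddθ, hdddu⟩ := guard_bounds3 hG hMN hus
  have hρpos := hE.density_pos s hs x
  have hθa : |θ s x| ≤ N := by rw [abs_of_pos (hE.temperature_pos s hs x)]; exact hθN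
  have hηmem : ρ s x * σ ^ 3 ∈ Icc 0 η₁ := ⟨(mul_pos hρpos (pow_pos hσ 3)).le, hpk.le⟩
  obtain ⟨bZ, bZ', bZ'', -, -, -⟩ := hband _ hηmem
  have hZa : |Zf (ρ s x * σ ^ 3)| ≤ N := bZ.trans hKN
  have hZ'a : |deriv Zf (ρ s x * σ ^ 3)| ≤ N := bZ'.trans hKN
  have hZ''a : |deriv (deriv Zf) (ρ s x * σ ^ 3)| ≤ N := bZ''.trans hKN
  have hσ3 : |σ ^ 3| ≤ 1 := by
    rw [abs_of_pos (pow_pos hσ 3)]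
    exact pow_le_one₀ hσ.le hσ1
  -- `C¹` slices
  have hρ1 : Torus.IsContDiff 1 (ρ s) := hρs.isContDiff (by simp)
  have hθ1 : Torus.IsContDiff 1 (θ s) := hθs.isContDiff (by simp)
  have huj1 : ∀ k, Torus.IsContDiff 1 (fun y => u s y k) := fun k =>
    isContDiff_apply_coord (hus.isContDiff (by simp)) k
  have hDρ1 : Torus.IsContDiff 1 (Torus.partialDeriv j (ρ s)) :=
    (hρs.partialDeriv j).isContDiff (by simp)
  have hDθ1 : ∀ k, Torus.IsContDiff 1 (Torus.partialDeriv k (θ s)) := fun k =>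
    (hθs.partialDeriv k).isContDiff (by simp)
  have hDDθ1 : ∀ k, Torus.IsContDiff 1 (Torus.partialDeriv j (Torus.partialDeriv k (θ s))) :=
    fun k => ((hθs.partialDeriv k).partialDeriv j).isContDiff (by simp)
  have hDu1 : ∀ k l, Torus.IsContDiff 1 (Torus.partialDeriv k (fun y => u s y l)) := fun k l =>
    ((hus.apply l).partialDeriv k).isContDiff (by simp)
  have hDDu1 : ∀ k, Torus.IsContDiff 1
      (Torus.partialDeriv j (Torus.partialDeriv k (fun y => u s y k))) := fun k =>
    (((hus.apply k).partialDeriv k).partialDeriv j).isContDiff (by simp)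
  -- exchange `∂ₜ∂ᵢ = ∂ᵢ∂ₜ` and the once differentiated temperature equation
  rw [torus_timeDerivWithin_Ico_partialDeriv_comm
    (hE.smooth_temperature.partialDeriv (uniqueDiffOn_Ico 0 T) j) hs i x]
  have hfun : Torus.timeDerivWithin (Ico 0 T) (fun s => Torus.partialDeriv j (θ s)) s = fun y =>
      -(Torus.partialDeriv j (fun z => u s z 0) y * Torus.partialDeriv 0 (θ s) y +
            u s y 0 * Torus.partialDeriv j (Torus.partialDeriv 0 (θ s)) y +
          (Torus.partialDeriv j (fun z => u s z 1) y * Torus.partialDeriv 1 (θ s) y +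
            u s y 1 * Torus.partialDeriv j (Torus.partialDeriv 1 (θ s)) y) +
          (Torus.partialDeriv j (fun z => u s z 2) y * Torus.partialDeriv 2 (θ s) y +
            u s y 2 * Torus.partialDeriv j (Torus.partialDeriv 2 (θ s)) y)) -
        2 / 3 * ((Torus.partialDeriv j (θ s) y * Zf (ρ s y * σ ^ 3) +
            θ s y * (deriv Zf (ρ s y * σ ^ 3) * σ ^ 3 * Torus.partialDeriv j (ρ s) y)) *
            (Torus.partialDeriv 0 (fun z => u s z 0) y + Torus.partialDeriv 1 (fun z => u s z 1) y +
              Torus.partialDeriv 2 (fun z => u s z 2) y) +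
          θ s y * Zf (ρ s y * σ ^ 3) *
            (Torus.partialDeriv j (Torus.partialDeriv 0 (fun z => u s z 0)) y +
              Torus.partialDeriv j (Torus.partialDeriv 1 (fun z => u s z 1)) y +
              Torus.partialDeriv j (Torus.partialDeriv 2 (fun z => u s z 2)) y)) := by
    funext y
    rw [LogSlope.timeDeriv_dTemperature hE hZ hEq hσ hη₀ hs y j]
    simp only [Fin.sum_univ_three]
  -- bookkeeping atoms along the `i`-th coordinate line through `x`
  have Pu := fun k => bd_coord (huj1 k) x i (hu k) (hdu i k)
  have Pdju := fun k => bd_coord (hDu1 j k) x i (hdu j k) (hddu i j k)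
  have Pdθ := fun k => bd_coord (hDθ1 k) x i (hdθ k) (hddθ i k)
  have Pddθ := fun k => bd_coord (hDDθ1 k) x i (hddθ j k) (hdddθ i j k)
  have Pθ := bd_coord hθ1 x i hθa (hdθ i)
  have Pdρ := bd_coord hDρ1 x i (hdρ j) (hddρ i j)
  have Pdiv := fun k => bd_coord (hDu1 k k) x i (hdu k k) (hddu i k k)
  have Pddiv := fun k => bd_coord (hDDu1 k) x i (hddu j k k) (hdddu i j k k)
  have hZl : |deriv (fun r => Zf (r * σ ^ 3)) (ρ s x) * Torus.partialDeriv i (ρ s) x| ≤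
      N * 1 * N := by
    rw [hdζ _ (hρJ s hs x)]
    exact abs_mul_le_of_le (abs_mul_le_of_le hZ'a hσ3) (hdρ i)
  have hZ'l : |deriv (fun r => deriv Zf (r * σ ^ 3)) (ρ s x) * Torus.partialDeriv i (ρ s) x| ≤
      N * 1 * N := by
    rw [hdζ1 _ (hρJ s hs x)]
    exact abs_mul_le_of_le (abs_mul_le_of_le hZ''a hσ3) (hdρ i)
  have PZ := bd_coord_comp hρ1 hJ hζ x (hρJ s hs x) i hZa hZl
  have PZ' := bd_coord_comp hρ1 hJ hζ1 x (hρJ s hs x) i hZ'a hZ'l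
  have h23 : |(2 / 3 : ℝ)| ≤ 1 := by norm_num
  have B := fun k : Fin 3 => bd_add (bd_mul (Pdju k) (Pdθ k)) (bd_mul (Pu k) (Pddθ k))
  obtain ⟨v, hv, -, hb⟩ := bd_sub (bd_neg (bd_add (bd_add (B 0) (B 1)) (B 2)))
    (bd_const_mul (2 / 3) h23 (bd_add
      (bd_mul (bd_add (bd_mul (Pdθ j) PZ) (bd_mul Pθ (bd_mul (bd_mul_const (σ ^ 3) hσ3 PZ') Pdρ)))
        (bd_add (bd_add (Pdiv 0) (Pdiv 1)) (Pdiv 2)))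
      (bd_mul (bd_mul Pθ PZ) (bd_add (bd_add (Pddiv 0) (Pddiv 1)) (Pddiv 2)))))
  have e : Torus.partialDeriv i
      (Torus.timeDerivWithin (Ico 0 T) (fun s => Torus.partialDeriv j (θ s)) s) x = v := by
    rw [hfun]
    refine partialDeriv_eq_of_hasDerivAt ?_
    exact hasDerivWithinAt_univ.1 hv
  rw [e]
  simp only [Fin.sum_univ_three]
  have c0 := abs_mul_le_of_le (hu 0) (hdddθ 0 i j)
  have c1 := abs_mul_le_of_le (hu 1) (hdddθ 1 i j)
  have c2 := abs_mul_le_of_le (hu 2) (hdddθ 2 i j)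
  have key := (abs_add_le _ _).trans (add_le_add hb
    ((abs_add_le _ _).trans (add_le_add ((abs_add_le _ _).trans (add_le_add c0 c1)) c2)))
  refine key.trans ?_
  have p05 : 0 ≤ N ^ 5 := by positivity
  have p25 : N ^ 2 ≤ N ^ 5 := pow_le_pow_right₀ hN (by norm_num)
  have p35 : N ^ 3 ≤ N ^ 5 := pow_le_pow_right₀ hN (by norm_num)
  have p45 : N ^ 4 ≤ N ^ 5 := pow_le_pow_right₀ hN (by norm_num)
  ring_nf
  linarith

end Eulerian

end Summit.AtomisticToContinuum.HydrodynamicLimit.Theorems.ConeLocalisation.Elevator.LogCurvature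

namespace Summit.AtomisticToContinuum.HydrodynamicLimit.Theorems.ConeLocalisation.Elevator

open Literature.MathematicalPhysics.KineticTheory Literature.Analysis.FunctionSpaces

/-- **Registered sub-goal `stub_logCurvature_partB` of the stub `stub_logCurvature`** (part B of its proof,
registered on stmt-AtomisticToContinuum-12504 for the supports lane): the floor-free material form of the
log-density Hessian, `D_t ∂ᵢ∂ⱼ log ρ = -Σₖ ∂ᵢ∂ⱼ∂ₖuₖ - Σₖ (∂ᵢ∂ⱼuₖ ∂ₖL + ∂ⱼuₖ ∂ᵢ∂ₖL + ∂ᵢuₖ ∂ₖ∂ⱼL)`. [folklore] -/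
theorem stub_logCurvature_partB : ∀ {σ T : ℝ} {ρ θ : ℝ → T3 → ℝ} {u : ℝ → T3 → V3}, IsHardSphereEulerSolution σ T ρ u θ → ∀ {s : ℝ}, s ∈ Set.Ico 0 T → ∀ (x : T3) (i j : Fin 3), Torus.timeDerivWithin (Set.Ico 0 T) (fun s => Torus.partialDeriv i (Torus.partialDeriv j (fun z => Real.log (ρ s z)))) s x + ∑ k, u s x k * Torus.partialDeriv k (Torus.partialDeriv i (Torus.partialDeriv j (fun z => Real.log (ρ s z)))) x = -(∑ k, Torus.partialDeriv i (Torus.partialDeriv j (Torus.partialDeriv k (fun y => u s y k))) x) - ∑ k, (Torus.partialDeriv i (Torus.partialDeriv j (fun y => u s y k)) x * Torus.partialDeriv k (fun z => Real.log (ρ s z)) x + Torus.partialDeriv j (fun y => u s y k) x * Torus.partialDeriv i (Torus.partialDeriv k (fun z => Real.log (ρ s z))) x + Torus.partialDeriv i (fun y => u s y k) x * Torus.partialDeriv k (Torus.partialDeriv j (fun z => Real.log (ρ s z))) x) :=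
  fun hE _ hs x i j => LogCurvature.Dt_logCurv hE hs x i j

end Summit.AtomisticToContinuum.HydrodynamicLimit.Theorems.ConeLocalisation.Elevator

end
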